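import Summits.QuantumAdvantage.QuantumAdvantage.Theses.LinnikCubicClassGroups
import Literature.Computability.Complexity.QuadraticCongruencesFactNP
import Literature.Computability.Complexity.CodeFPModArith
import Literature.Computability.Complexity.CodeFPStringKit
import Literature.Computability.Complexity.CodeFPListKit
import Literature.Computability.Complexity.CodeFPLists
import Literature.Computability.Complexity.CodeFPStrings
import Literature.Computability.Complexity.RowSelectFP
import Literature.Computability.Cryptography.VanDamSeroussiOracleFP
import Literature.Computability.QuantumComplexity.HidingProgramMachine

/-!
# Crux `LinnikCubicClassGroups.PureCubicClassGroupFBQP` (stmt-QuantumAdvantage-11544) — stub `stub_assemblySampler`,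
piece (2a): the accepted coin-block values are an `FP` function of `⟨x, coins⟩`

Line `arakelov-giant-step-cycle`, S6b. The classical sampler hands to the quantum core the list `ACC x c C` of the
FIRST accepted value of each of `T = 600 B²` groups of `M = 38400 B³` blocks of `B = log₂ X + 1` coins
(`X = (27 m²)^C`, `m = decodeNat x`), a block value `v = bitsToNat (block)` being accepted iff `v` is prime (AKS, the
tree's `QuadCongNP.primeFn`), `v ≤ X` and `v ∤ 3m`. This file proves, in the tree's typed polynomial-time algebra
`CodeFP`, that `⟨x, c⟩ ↦ encode (ACC x c C)` is in `FP` (`stub_assemblySamplerAcc`, definition-free): parameters in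
binary and unary (`B = |bin X| + [X = 0]`), all `T·M` blocks by `strChunks`, their values by `strVal`, group `k` by
`rawDropUn`/`rawTakeUn`, the test, `find? = take 1 ∘ filter`, `filterMap = flatten ∘ map`.
-/

set_option linter.dupNamespace false

namespace Summit.QuantumAdvantage.QuantumAdvantage.Theorems.LinnikCubicClassGroups

open Computability (encodeNat decodeNat encodingNatBool)
open Literature.Computability.Complexity (boolPair boolUnpair boolUnpair_boolPair encodingListNatBool FP CodeFP
  comp_mem_FP bitsToNat)
open Literature.Computability.Complexity.CodeFP
open Literature.Computability.Complexity.Brick (canonF canonF_mem_FP canonF_eq_encodeNat_decodeNat)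

/-! ## List lemmas -/

/-- `find?` as a list: the first accepted element is `take 1` of the accepted ones. -/
theorem samplerAcc_take_one_filter {α : Type} (p : α → Bool) (l : List α) :
    (l.filter p).take 1 = (l.find? p).toList := by
  induction l with
  | nil => rfl
  | cons a l ih => rw [List.filter_cons, List.find?_cons]; by_cases h : p a <;> simp [h, ih]

/-- `filterMap` as a flattened `map` of option lists. -/
theorem samplerAcc_flatten_map_toList {α β : Type} (f : α → Option β) (l : List α) :
    (l.map fun a => (f a).toList).flatten = l.filterMap f := by
  induction l with
  | nil => rfl
  | cons a l ih => rw [List.map_cons, List.flatten_cons, ih, List.filterMap_cons]; cases f a <;> rfl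

/-- Group `k` of the list of all block values is the list of its `M` block values. -/
theorem samplerAcc_group (c : List Bool) (B M T k : ℕ) (hk : k < T) :
    ((((List.range (T * M)).map fun i => bitsToNat ((c.drop (i * B)).take B)).drop (k * M)).take M) =
      (List.range M).map fun j => bitsToNat ((c.drop ((k * M + j) * B)).take B) := by
  have hkM : k * M + M ≤ T * M := by
    have := Nat.mul_le_mul_right M hk; rw [Nat.succ_mul] at this; exact this
  refine List.ext_getElem (by simp [List.length_take, List.length_drop]; omega) fun j h₁ h₂ => ?_
  have hj : j < M := by simpa using h₂
  simp [List.getElem_take, List.getElem_drop, List.getElem_map, List.getElem_range]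

/-- `size X + [X = 0] = log₂ X + 1`. -/
theorem samplerAcc_size (X : ℕ) : Nat.size X + (if X = 0 then 1 else 0) = Nat.log 2 X + 1 := by
  rcases Nat.eq_zero_or_pos X with rfl | hx
  · simp
  rw [if_neg hx.ne']
  have h1 : 0 < Nat.size X := Nat.size_pos.2 hx
  have h2 : 2 ^ (Nat.size X - 1) ≤ X := Nat.lt_size.1 (by omega)
  have h3 : X < 2 ^ (Nat.size X - 1 + 1) := by rw [Nat.sub_add_cancel h1]; exact Nat.lt_size_self X
  have h4 : Nat.log 2 X = Nat.size X - 1 := Nat.log_eq_of_pow_le_of_lt_pow h2 h3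
  omega

/-! ## The program -/

/-- **The accepted values on codes** (context-free form over the pair `(x, c)`): with `m = decodeNat x`,
`X = (27m²)^C`, `B = log₂ X + 1`, `T = 600B²`, `M = 38400B³`, the list
`(range T).filterMap (k ↦ ((range M).map (j ↦ bitsToNat ((c.drop ((kM+j)B)).take B))).find? good)`. -/
theorem samplerAcc_codeFP (C : ℕ) : CodeFP (pairE strE strE) (rawE natE) (fun p =>
    (List.range (600 * (Nat.log 2 ((27 * decodeNat p.1 ^ 2) ^ C) + 1) ^ 2)).filterMap fun k =>
      ((List.range (38400 * (Nat.log 2 ((27 * decodeNat p.1 ^ 2) ^ C) + 1) ^ 3)).map fun j =>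
        bitsToNat ((p.2.drop ((k * (38400 * (Nat.log 2 ((27 * decodeNat p.1 ^ 2) ^ C) + 1) ^ 3) + j) *
          (Nat.log 2 ((27 * decodeNat p.1 ^ 2) ^ C) + 1))).take (Nat.log 2 ((27 * decodeNat p.1 ^ 2) ^ C) + 1))).find?
        fun v => decide (v.Prime ∧ v ≤ (27 * decodeNat p.1 ^ 2) ^ C ∧ ¬ v ∣ 3 * decodeNat p.1)) := by
  -- parameters
  have cDec : CodeFP strE natE decodeNat := ⟨canonF, canonF_mem_FP, fun w => canonF_eq_encodeNat_decodeNat w⟩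
  have cM : CodeFP (pairE strE strE) natE (fun p => decodeNat p.1) := cDec.comp (fst _ _)
  have cX : CodeFP (pairE strE strE) natE (fun p => (27 * decodeNat p.1 ^ 2) ^ C) :=
    natPow.comp ((natMul.comp ((const _ 27).pair (natPow.comp (cM.pair (const _ 2))))).pair (const _ C))
  have cBu : CodeFP (pairE strE strE) unE (fun p => Nat.log 2 ((27 * decodeNat p.1 ^ 2) ^ C) + 1) :=
    (unAdd.comp ((strLength.comp (strOfNat.comp cX)).pair ((natEq.comp (cX.pair (const _ 0))).ite (const _ 1)
      (const _ 0)))).congr fun p => by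
        dsimp only
        rw [length_natE, ← samplerAcc_size]
        by_cases h : (27 * decodeNat p.1 ^ 2) ^ C = 0 <;> simp [h]
  have cBn : CodeFP (pairE strE strE) natE (fun p => Nat.log 2 ((27 * decodeNat p.1 ^ 2) ^ C) + 1) :=
    (natOfUn.comp cBu).congr fun _ => rfl
  have cTu : CodeFP (pairE strE strE) unE (fun p => 600 * (Nat.log 2 ((27 * decodeNat p.1 ^ 2) ^ C) + 1) ^ 2) :=
    ((unMulConst 600).comp (Literature.Computability.QuantumComplexity.unMul_codeFP.comp (cBu.pair cBu))).congr fun _ => by dsimp only; ring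
  have cMu : CodeFP (pairE strE strE) unE (fun p => 38400 * (Nat.log 2 ((27 * decodeNat p.1 ^ 2) ^ C) + 1) ^ 3) :=
    ((unMulConst 38400).comp (Literature.Computability.QuantumComplexity.unMul_codeFP.comp (cBu.pair (Literature.Computability.QuantumComplexity.unMul_codeFP.comp (cBu.pair cBu))))).congr
      fun _ => by dsimp only; ring
  have cMn : CodeFP (pairE strE strE) natE (fun p => 38400 * (Nat.log 2 ((27 * decodeNat p.1 ^ 2) ^ C) + 1) ^ 3) :=
    (natOfUn.comp cMu).congr fun _ => rfl
  have cNu : CodeFP (pairE strE strE) unE (fun p => 600 * (Nat.log 2 ((27 * decodeNat p.1 ^ 2) ^ C) + 1) ^ 2 *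
      (38400 * (Nat.log 2 ((27 * decodeNat p.1 ^ 2) ^ C) + 1) ^ 3)) := Literature.Computability.QuantumComplexity.unMul_codeFP.comp (cTu.pair cMu)
  -- all block values
  have cVals : CodeFP (pairE strE strE) (rawE natE) (fun p =>
      (List.range (600 * (Nat.log 2 ((27 * decodeNat p.1 ^ 2) ^ C) + 1) ^ 2 *
        (38400 * (Nat.log 2 ((27 * decodeNat p.1 ^ 2) ^ C) + 1) ^ 3))).map fun i =>
        bitsToNat ((p.2.drop (i * (Nat.log 2 ((27 * decodeNat p.1 ^ 2) ^ C) + 1))).take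
          (Nat.log 2 ((27 * decodeNat p.1 ^ 2) ^ C) + 1))) :=
    ((map₀ strVal).comp (strChunks.comp (cNu.pair (cBu.pair (snd _ _))))).congr fun p => by
      simp only [List.map_map]; rfl
  -- the test, in the context `((x, c), v)`
  have cTest : CodeFP (pairE (pairE strE strE) natE) bitE
      (fun t => decide (t.2.Prime ∧ t.2 ≤ (27 * decodeNat t.1.1 ^ 2) ^ C ∧ ¬ t.2 ∣ 3 * decodeNat t.1.1)) :=
    (((Literature.Computability.Cryptography.VDSOracle.codeFP_prime.comp (snd _ _)).and (natLe.comp ((snd _ _).pair (cX.comp (fst _ _))))).and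
      (natEq.comp ((natMod.comp ((natMul.comp ((const _ 3).pair (cM.comp (fst _ _)))).pair (snd _ _))).pair
        (const _ 0))).not).congr fun t => by
          have h3' : (3 * decodeNat t.1.1 % t.2 = 0) ↔ t.2 ∣ 3 * decodeNat t.1.1 := (Nat.dvd_iff_mod_eq_zero).symm
          dsimp only
          simp only [h3']
          by_cases h1 : t.2.Prime <;> by_cases h2 : t.2 ≤ (27 * decodeNat t.1.1 ^ 2) ^ C <;>
            by_cases h3 : t.2 ∣ 3 * decodeNat t.1.1 <;> simp [h1, h2, h3]
  -- group `k`: its values, the first accepted one as a list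
  have cGrp : CodeFP (pairE (pairE strE strE) natE) (rawE natE) (fun t =>
      ((((List.range (600 * (Nat.log 2 ((27 * decodeNat t.1.1 ^ 2) ^ C) + 1) ^ 2 *
        (38400 * (Nat.log 2 ((27 * decodeNat t.1.1 ^ 2) ^ C) + 1) ^ 3))).map fun i =>
        bitsToNat ((t.1.2.drop (i * (Nat.log 2 ((27 * decodeNat t.1.1 ^ 2) ^ C) + 1))).take
          (Nat.log 2 ((27 * decodeNat t.1.1 ^ 2) ^ C) + 1))).drop
        (t.2 * (38400 * (Nat.log 2 ((27 * decodeNat t.1.1 ^ 2) ^ C) + 1) ^ 3))).take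
        (38400 * (Nat.log 2 ((27 * decodeNat t.1.1 ^ 2) ^ C) + 1) ^ 3))) := by
    have cOff : CodeFP (pairE (pairE strE strE) natE) unE (fun t => min
        (t.2 * (38400 * (Nat.log 2 ((27 * decodeNat t.1.1 ^ 2) ^ C) + 1) ^ 3))
        (600 * (Nat.log 2 ((27 * decodeNat t.1.1 ^ 2) ^ C) + 1) ^ 2 *
          (38400 * (Nat.log 2 ((27 * decodeNat t.1.1 ^ 2) ^ C) + 1) ^ 3))) :=
      unOfNatMin.comp ((cNu.comp (fst _ _)).pair (natMul.comp ((snd _ _).pair (cMn.comp (fst _ _)))))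
    refine (((rawTakeUn natE).comp ((cMu.comp (fst _ _)).pair ((rawDropUn natE).comp (cOff.pair
      (cVals.comp (fst _ _)))))).congr fun t => ?_)
    dsimp only
    by_cases h : t.2 * (38400 * (Nat.log 2 ((27 * decodeNat t.1.1 ^ 2) ^ C) + 1) ^ 3) ≤
        600 * (Nat.log 2 ((27 * decodeNat t.1.1 ^ 2) ^ C) + 1) ^ 2 * (38400 * (Nat.log 2 ((27 * decodeNat t.1.1 ^ 2) ^ C) + 1) ^ 3)
    · rw [Nat.min_eq_left h]
    · rw [Nat.min_eq_right (le_of_not_ge h), List.drop_of_length_le (by simp), List.drop_of_length_le (by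
        rw [List.length_map, List.length_range]; exact le_of_not_ge h)]
  have cSel : CodeFP (pairE (pairE strE strE) natE) (rawE natE) (fun t =>
      (((((List.range (600 * (Nat.log 2 ((27 * decodeNat t.1.1 ^ 2) ^ C) + 1) ^ 2 *
        (38400 * (Nat.log 2 ((27 * decodeNat t.1.1 ^ 2) ^ C) + 1) ^ 3))).map fun i =>
        bitsToNat ((t.1.2.drop (i * (Nat.log 2 ((27 * decodeNat t.1.1 ^ 2) ^ C) + 1))).take
          (Nat.log 2 ((27 * decodeNat t.1.1 ^ 2) ^ C) + 1))).drop
        (t.2 * (38400 * (Nat.log 2 ((27 * decodeNat t.1.1 ^ 2) ^ C) + 1) ^ 3))).take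
        (38400 * (Nat.log 2 ((27 * decodeNat t.1.1 ^ 2) ^ C) + 1) ^ 3)).filter fun v =>
          decide (v.Prime ∧ v ≤ (27 * decodeNat t.1.1 ^ 2) ^ C ∧ ¬ v ∣ 3 * decodeNat t.1.1)).take 1) := by
    have cPiece : CodeFP (pairE (pairE strE strE) natE) (rawE natE) (fun t =>
        if decide (t.2.Prime ∧ t.2 ≤ (27 * decodeNat t.1.1 ^ 2) ^ C ∧ ¬ t.2 ∣ 3 * decodeNat t.1.1) then [t.2] else []) :=
      cTest.ite ((rawSingleton natE).comp (snd _ _)) (const _ [])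
    have cFilt := ((flatten natE).comp ((CodeFP.map cPiece).comp ((fst _ _).pair cGrp)))
    exact ((rawTakeNat natE).comp ((const _ 1).pair cFilt)).congr fun t => by
      dsimp only; rw [Literature.Computability.Complexity.RowSelectFP.flatten_map_ite]
  -- all groups
  refine ((flatten natE).comp ((CodeFP.map cSel).comp ((CodeFP.id _).pair (urange.comp cTu)))).congr fun p => ?_
  dsimp only [id]
  rw [← samplerAcc_flatten_map_toList]
  refine congrArg List.flatten (List.map_congr_left fun k hk => ?_)
  rw [samplerAcc_take_one_filter, samplerAcc_group _ _ _ _ _ (List.mem_range.1 hk)]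
  congr

/-- **S6b (2a) `stub_assemblySamplerAcc`**: the accepted coin-block values, encoded, are an `FP` function of `⟨x, c⟩`. -/
theorem stub_assemblySamplerAcc : ∀ C : ℕ, ∃ acc : List Bool → List Bool, acc ∈ FP ∧ ∀ x c : List Bool,
    acc (boolPair x c) = encodingListNatBool.encode
      ((List.range (600 * (Nat.log 2 ((27 * decodeNat x ^ 2) ^ C) + 1) ^ 2)).filterMap fun k =>
        ((List.range (38400 * (Nat.log 2 ((27 * decodeNat x ^ 2) ^ C) + 1) ^ 3)).map fun j =>
          bitsToNat ((c.drop ((k * (38400 * (Nat.log 2 ((27 * decodeNat x ^ 2) ^ C) + 1) ^ 3) + j) *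
            (Nat.log 2 ((27 * decodeNat x ^ 2) ^ C) + 1))).take
            (Nat.log 2 ((27 * decodeNat x ^ 2) ^ C) + 1))).find? fun v =>
          decide (v.Prime ∧ v ≤ (27 * decodeNat x ^ 2) ^ C ∧ ¬ v ∣ 3 * decodeNat x)) := by
  intro C
  obtain ⟨acc, hacc, hs⟩ := (listOfRaw natE).comp (samplerAcc_codeFP C)
  refine ⟨acc, hacc, fun x c => ?_⟩
  rw [show (encodingListNatBool.encode : List ℕ → List Bool) = listE natE from listE_eq encodingNatBool]
  have h := hs (x, c)
  dsimp only [pairE, strE, id] at h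
  exact h

end Summit.QuantumAdvantage.QuantumAdvantage.Theorems.LinnikCubicClassGroups
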